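import Mathlib
import Summits.ResolutionOfSingularities.ResolutionOfSingularities.Theses.Valuative
import Literature.AlgebraicGeometry.Resolution.ProperModelsPatchingGluing
import Literature.AlgebraicGeometry.Morphisms.OpenGluingProofs
import Literature.AlgebraicGeometry.Morphisms.NagataCompactification

/-!
# Crux `PatchingRel` (stmt-ResolutionOfSingularities-0642) — line `sandwiched-gluing`, SKELETON (cycle 1 end, published form)

`PatchingRel : ∀ p prime, LUrel_p → ResolutionInChar.{0} p` (route `Valuative` rank 3 = route
`CyclicCovers` rank 6). Composition (all dimension-free; PROPER models of the function field,
`Literature.AlgebraicGeometry.Resolution.ProperModel`):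

  PatchingRel
    ⇐ ∀ p prime, TwoModelPatching p + LUrel_p    [stub 1 LANDED: Theorems/ValuativePatchingRelResolvingSystem (p73001);
                                                   Literature ZariskiPatchingProperModels]
  TwoModelPatching p ⇐ RegLeification p           [PROVED: SandwichedGluing.twoModelPatching_of_regLeification (p74567)]
  RegLeification p ⇐ Extension + LocalRegLeification p   [stub 2 LANDED: …RegLeificationOfLocal (p73712); ProperModelsRegLeification]
  LocalRegLeification p ⇐ OpenGluing + SAND⁺(p)   [stub 3 LANDED: …LocalRegLeification (p75893); LocalRegLeificationOfSandwiched /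
                                                   ProperModelsPatchingGluing]
  OpenGluing                                      [stub 4 LANDED, named fact DISCHARGED: …OpenGluing (p76250); OpenGluingProofs p74344]
  Extension ⇐ NagataCompactification              [stub 5 LANDED: …ProperExtension (p75249); ProperModelsExtension]
  NagataCompactification                          [stub 6 OPEN: NAMED FACT, Conrad 2007 Thm 4.1 — literature debt]
  SAND⁺(p) = SandwichedStrongResolution p         [stub 7 OPEN: the residual atom; dim ≤ 3 = CossartPiltant2019General
                                                   (Disproof T4), dim ≥ 4 open and summit-calibre (Disproof T5)]

The crux is CLOSED MODULO {NagataCompactification, ∀ p prime SAND⁺(p)}; the sorry-free capstone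
`patchingRel_of_nagata_of_sandwiched` is `Theorems/ValuativePatchingRel.lean` (p76791). This
published form imports only built Literature modules (the five stub files are equivalent wrappers)
so that it elaborates on the farm today; `work/PatchingRel.lean` in the lead's folder is the form
importing the stub files themselves.
Lead: prover-line-stmt-ResolutionOfSingularities-0642-0, 2026-08-16.
-/

-- `Summit.<Summit>.<Sub>.Theorems` with `Sub = Summit` (single-conjunct summit, D-0017): the duplicated
-- namespace component is the tree layout.
set_option linter.dupNamespace false

noncomputable section

open CategoryTheory AlgebraicGeometry
open Literature.AlgebraicGeometry.Resolution Literature.AlgebraicGeometry.Morphisms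

namespace Summit.ResolutionOfSingularities.ResolutionOfSingularities.Cruxes.PatchingRel.SandwichedGluingLine

/-! ## Open stubs (registered on the item under exactly these names and signatures) -/

/-- Stub 6: NAMED FACT Nagata compactification (Conrad 2007 Thm. 4.1; Stacks 0F41) — to be
discharged by a literature-prover (`NagataCompactification_holds`). [cite: Conrad2007, Thm. 4.1] -/
theorem stub_nagataCompactification : NagataCompactification.{0} := by
  sorry

/-- Stub 7 (the residual atom, OPEN in dimension ≥ 4): strong resolution of sandwiched schemes in
characteristic `p`. [folklore] -/
theorem stub_sandwichedStrongResolution : ∀ p : ℕ, p.Prime → SandwichedStrongResolution.{0} p := by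
  sorry

/-! ## Composition -/

/-- **Line `sandwiched-gluing` closes the crux modulo its two open stubs.** [folklore] -/
theorem PatchingRel_of :
    Summit.ResolutionOfSingularities.ResolutionOfSingularities.Theses.Valuative.PatchingRel := by
  intro p hp hLU
  exact SandwichedGluing.resolutionInChar_of_nagata_openGluing_sand p stub_nagataCompactification
    OpenGluing_holds (stub_sandwichedStrongResolution p hp) hLU

end Summit.ResolutionOfSingularities.ResolutionOfSingularities.Cruxes.PatchingRel.SandwichedGluingLine

end
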